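import Summits.HodgeConjecture.HodgeConjecture.Theses.HeckePrymWeil

/-!
# Route HeckePrymWeil — Assembly (item stmt-HodgeConjecture-1265)

The assembly item of route `route-HodgeConjecture-HeckePrymWeil` is the implication

`HodgeWeilLadder → WeilDescending → SummitOffWeilSector → HodgeConjecture`.

It is pure logic and ℕ-arithmetic.  `SummitOffWeilSector` is, by definition, the implication
"(every rational `(n,n)` Hodge–Weil class of every `(A, φ)` with `φ ≫ φ = -p`, `p ≡ 3 (4)` prime,
`p ≥ 7`, in every dimension `2n ≥ 2`, is algebraic) → HodgeConjecture", so it suffices to produce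
that sector from the ladder and the descending lemma.  Write `HWA(p, n)` for the rung predicate in
dimension `2n`.  `HodgeWeilLadder` gives `HWA(p, M * (g - 1))` for every `g ≥ 2`, where
`M = (p - 1) / 2 ≥ 3`, and `WeilDescending` gives `HWA(p, n + 1) → HWA(p, n)` for `n ≥ 1`.  For a given
`n ≥ 1` take the rung `g = n + 1`, i.e. `HWA(p, M * n)` with `M * n ≥ n`, and descend `M * n - n`
times.  The combinatorial core is isolated as `ladder_descent`, stated over an abstract rung
predicate `P : ℕ → Prop` so that the (long) rung predicate is supplied by unification.

The same argument is the route's deciding theorem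
`Summit.HodgeConjecture.HodgeConjecture.Theses.HeckePrymWeil.closes`; the proof below is
self-contained (it does not refer to `closes`) so that it does not depend on the binder order or
the regeneration of that theorem.
-/

namespace Summit.HodgeConjecture.HodgeConjecture.Theorems

open Summit.HodgeConjecture.HodgeConjecture.Theses.HeckePrymWeil

/-- **Ladder descent** (pure ℕ-arithmetic): if a predicate `P` on ℕ holds at every rung
`M * (g - 1)`, `g ≥ 2`, of a ladder with step `M ≥ 1`, and descends one step at a time
(`P (n + 1) → P n` for `n ≥ 1`, phrased with the successor bound by an equation as in
`WeilDescending`), then `P n` holds for every `n ≥ 1`: reach `n` from the rung `M * n ≥ n`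
(take `g = n + 1`) by `M * n - n` descents. -/
theorem heckePrymWeil_ladder_descent (P : ℕ → Prop) (M : ℕ) (hM : 1 ≤ M)
    (hLad : ∀ g : ℕ, 2 ≤ g → ∀ n : ℕ, n = M * (g - 1) → P n)
    (hDesc : ∀ n : ℕ, 1 ≤ n → (∀ m : ℕ, m = n + 1 → P m) → P n) :
    ∀ n : ℕ, 1 ≤ n → P n := by
  intro n hn
  have hMn : n ≤ M * n :=
    calc n = 1 * n := (Nat.one_mul n).symm
      _ ≤ M * n := Nat.mul_le_mul_right n hM
  -- `key d`: every `k ≥ 1` at distance `d` below the rung `M * n` satisfies `P`.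
  have key : ∀ d k : ℕ, 1 ≤ k → k + d = M * n → P k := by
    intro d
    induction d with
    | zero =>
      intro k hk hkd
      refine hLad (n + 1) (by omega) k ?_
      rw [Nat.add_sub_cancel]
      omega
    | succ d ih =>
      intro k hk hkd
      exact hDesc k hk fun m hm => ih m (by omega) (by omega)
  exact key (M * n - n) n hn (by omega)

/-- **Assembly of route HeckePrymWeil** (item stmt-HodgeConjecture-1265):
`HodgeWeilLadder → WeilDescending → SummitOffWeilSector → HodgeConjecture`.
Given the ladder `hL` and the descending lemma `hD`, the whole ℚ(√-p) Hodge–Weil sector follows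
by `heckePrymWeil_ladder_descent` with step `M = (p - 1) / 2` (which is `≥ 1` since `p ≥ 7`), the
rung predicate being supplied by unification; `SummitOffWeilSector` then yields the Hodge
conjecture. -/
theorem heckePrymWeil_assembly_proof :
    Summit.HodgeConjecture.HodgeConjecture.Theses.HeckePrymWeil.Assembly := by
  unfold Summit.HodgeConjecture.HodgeConjecture.Theses.HeckePrymWeil.Assembly
  intro hL hD hS
  refine hS fun p hp hp4 hp7 => ?_
  exact heckePrymWeil_ladder_descent _ ((p - 1) / 2) (by omega) (hL p hp hp4 hp7) (hD p hp hp4 hp7)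

end Summit.HodgeConjecture.HodgeConjecture.Theorems
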